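import Summits.QuantumFields.YangMills.Theorems.UnitScaleTiltProp7LocalProjectorRowMember
import Summits.QuantumFields.YangMills.Theorems.UnitScaleTiltProp7DivSliceOfMemberDivSq
import Summits.QuantumFields.YangMills.Theorems.UnitScaleTiltProp7Lane2OverlapRows
import Summits.QuantumFields.YangMills.Theorems.UnitScaleTiltProp7BlockDistanceWeights
import HarnessLib

/-!
# Route `UnitScaleTilt`, crux K1 «MinimiserStabilityRegPr» (stmt-QuantumFields-19200), EX row `hGF[Lift]` (curved member) — **LOD LINE, PEN (L5″) `hloc` PER CUBE — THE ADAPTER: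
# px10 g11's DISPLAYED ROW `hloc` OF ✓`Prop7LODAssemblyMember.curvedTarget_member` (p759065 :120) PRODUCED LETTER FOR LETTER** from this seat's member `hloc`
# ✓`Prop7LocalProjectorRowMember.norm_inner_projR_sub_projR_le_of_opRow` (p759359).  Per cube centre `c` the background is the cube-gauged `W_c = (axialT U₀ c)·U₀` (`RegPr` by
# ✓`regPr_gaugeAct_iff`), the vector is `f_c = D*_{W_c}(toL2 X̃)` for bond fields `X` supported within `R₀ = 3·L^s·ℓ` of `c` (✓p757454's `hX`), and:
# * §1 the D* STENCIL SUPPORT: `(toL2S)⁻¹ f_c` vanishes at sites farther than `R₀ + 1` from `c` (✓`toL2S_symm_DstarL2_toL2_eq` + ✓`divB_eq_zero_of_vanish`), hence lives on the coarse blocks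
#   `S_c = {z : tdist(z, blk c) ≤ 3L^s + 4}` (B3 ✓`tdist_iterBlockOf_le`);
# * §2 the BRIDGE between px5 g11's COARSE-FUNCTION currency (`c = ι d♭`, `d♭` supported in a block set) and this seat's SPIKE-SUM currency (`Σ_y d_y • b_c y` supported in an index set):
#   for ANY predicate `B` on vectors, a row over all block-supported `ι d♭` gives the row over all index-supported spike sums (B2c ✓`spike_eq_lift`);
# * §3 ★★★ `hloc_of_cube_rows`: px10's binder VERBATIM (`∀ c, ∃ Qc, ⟨the averaging sequence of record at W_c⟩ ∧ ∀ X, hX → ‖⟪f_c, (f_c − R_{Qc}f_c) − (f_c − R_{Q1}f_c)⟫‖ ≤ δP‖f_c‖²`)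
#   from per-cube FAMILIES of intertwiner ∕ adjoint ∕ massive-inverse letters `Qc Tc Gc` (any data with `hseq_c hT_c hAG_c hGA_c` — px10 picks the data of record), the flat system
#   `Q1 T1 G1` at background `1`, the windows ∕ gap (background-free), the near radius `r`, and THREE px5-class rows PER CUBE in px5's own shapes: the (RN-near) operator row `hop` for
#   every coarse `d♭` supported in the blocks within `r` of `S_c` (= the conclusion of px5 g11's ✓`Prop7GramDifferenceNearRowMember.norm_gram_apply_sub_le_near_member`), and (RB1)∕(RB2)
#   at `f_c`; `δP` = ✓p759359's explicit opRow constant (K-free after ★p1's pin (2) `c₁ := c₀(L³)^{K−n}`, `a := 1`; read as the letter `δP` by w2 g12's §2 window).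

Cell `ym3-torus` (HUMAN RULING D-0037, YM ladder rung R3 — NOT d = 4, NOT infinite volume, NOT a mass gap, NOT Clay).  Width seat `ym-routeR-w2` gen 13 (px10 g11 03:09:35Z division (b);
★p1 g24 03:24:41Z book).  THEOREMS ONLY (0 `def`, 0 `sorry`); `--supports stmt-QuantumFields-19200 --as helper`, count-neutral.  HONEST LABEL (★★OWNER RULING №33 (6)): curved γ-row supplier
line (LOD localisation), pen (L5″); packaging of landed rows; CONDITIONAL on px5's three rows per cube, the windows∕gap and `n < K`; the quantitative flag of record (`m_B⁻² ≈ 1.4·10¹⁶` at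
the pin) multiplies `δP`; nothing of (3.49), Thm 3.1∕3.3, `hT`, `hGF`, EX ∕ 19200 is proved here; no summit statement is proved by this seat.

WHAT IS PROVED (ns `Summit.QuantumFields.YangMills.Theorems.Prop7LocalProjectorRowCube`).
* §1 ★ `toL2S_symm_DstarL2_toL2_eq_zero_of_far`, ★ `dstar_blockSupport` (the source `(toL2S)⁻¹ f_c` lives on `S_c`).
* §2 ★ `coarseRow_to_spikeRow` (px5's coarse-function rows ⟹ spike-sum rows, any predicate).
* §3 ★★★ `hloc_of_cube_rows` (px10 g11's `hloc` binder, letter for letter).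

References: T. Bałaban, CMP **99** (1985) 389–434 [Balaban1985BackgroundPropagators] ((3.8) p.392, (3.20)–(3.26) pp.394–395, (3.49) p.399, (3.105)–(3.106) p.414); CMP **98** (1985) 17–51
[Balaban1985Averaging] ((2) p.17).
-/

set_option autoImplicit false

noncomputable section

open scoped BigOperators Matrix.Norms.L2Operator InnerProductSpace ComplexConjugate Matrix

open Literature.MathematicalPhysics.QuantumFieldTheory.Balaban1983to89
open T4Continuum BlockAveraging
open BlockAveraging (Idx)
open B7Prop1Explicit (U1 disp)
open B5Eq118OneStroke (iterBlockOf iterBlock mem_iterBlock)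
open B10Eq27TorusAxialLog (holT transl axialT unitsField toUField)
open B7TransferAnalyticMean (meanCLM)
open B9Eq39Adjoint (divB)
open B9TorusCalculus (torusT)
open B11Eq103H1Complex (SiteL2K BondL2K projR)
open Summit.QuantumFields.YangMills.Theorems.Prop8Chart (emlIterU)
open Literature.MathematicalPhysics.QuantumFieldTheory.Balaban1983to89.T3ContinuumYM3Torus
open T3SectALandauChart (eta eta_pos bgUnits)
open T3PrintedRegularMinimiser (RegPr regPr_one)
open T3PrintedRegularOrbits (sites_eq regPr_gaugeAct_iff)
open T3LevelShift (siteShift)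
open Summit.QuantumFields.YangMills.Theorems.Prop7SectET3Transport (periodsT3)
open Summit.QuantumFields.YangMills.Theorems.Prop7SectET3HilbertLetters (W₂ toL2 toL2S DstarL2 covLapSite)
open Summit.QuantumFields.YangMills.Theorems.Prop7SiteEntryCoordinates (orthonormal_spike top_le_span_spike)
open Summit.QuantumFields.YangMills.Theorems.Prop7CoarseGramInverseDecay (spike_eq_lift)
open Summit.QuantumFields.YangMills.Theorems.Prop7DivSliceOfMemberDivSq (toL2S_symm_DstarL2_toL2_eq)
open Summit.QuantumFields.YangMills.Theorems.Prop7Lane2OverlapRows (divB_eq_zero_of_vanish)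
open Summit.QuantumFields.YangMills.Theorems.Prop7BlockDistanceWeights (tdist_iterBlockOf_le tdist_coarse_comm)
open Summit.QuantumFields.YangMills.Theorems.Prop7LocalProjectorRowMember (norm_inner_projR_sub_projR_le_of_opRow)

namespace Summit.QuantumFields.YangMills.Theorems.Prop7LocalProjectorRowCube

variable (F : T3Family) {n K : ℕ} (h : n ≤ K) {c₀ c₁ : ℝ} [Fact (0 < c₀)] [Fact (0 < c₁)]

/-! ## §1 The D* stencil support -/

omit [Fact (0 < c₁)] in
/-- ★ **THE D* STENCIL READS ONLY THE BONDS AT A SITE**: if the bond field `X` vanishes on every bond whose source is farther than `R₀` from `c`, then `(toL2S)⁻¹(D*_W(toL2 X))`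
vanishes at every site farther than `R₀ + 1` from `c` (`D*` at `x` reads `X⟨x, μ⟩` and `X⟨x − e_μ, μ⟩`; ✓`toL2S_symm_DstarL2_toL2_eq`, ✓`divB_eq_zero_of_vanish`).
[cite: Balaban1985BackgroundPropagators, (3.8) p.392] -/
theorem toL2S_symm_DstarL2_toL2_eq_zero_of_far (W : GaugeField (F.P K) 0 (Matrix.specialUnitaryGroup (Fin 2) ℂ)) (X : PBond (F.P K) 0 → Matrix (Fin 2) (Fin 2) ℂ)
    (c : Site (F.P K) 0) {R₀ : ℕ} (hX : ∀ b : PBond (F.P K) 0, X b ≠ 0 → Site.tdist c b.src ≤ R₀) (x : Site (F.P K) 0) (hx : R₀ + 1 < Site.tdist c x) :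
    (toL2S F K c₀).symm (DstarL2 F n K c₀ W (toL2 F K c₀ X)) x = 0 := by
  rw [toL2S_symm_DstarL2_toL2_eq F n K c₀ W X]
  have h1 : ∀ μ : Fin (F.P K).d, X ⟨x, μ⟩ = 0 := by
    intro μ
    by_contra hne
    have := hX ⟨x, μ⟩ hne
    simp only at this
    omega
  have h2 : ∀ μ : Fin (F.P K).d, X ⟨x.unshift μ, μ⟩ = 0 := by
    intro μ
    by_contra hne
    have hle := hX ⟨x.unshift μ, μ⟩ hne
    simp only at hle
    have hstep : Site.tdist (x.unshift μ) x ≤ 1 := by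
      have := Summit.QuantumFields.Balaban3D.Proofs.Run3Collar.tdist_shift_le (x.unshift μ) μ
      rwa [B10StarCount.shift_unshift] at this
    have htri := B3Taylor310LocalRemainder.tdist_triangle c (x.unshift μ) x
    omega
  show (eta F n K)⁻¹ • divB (torusT (F.P K) 0) (fun κ z => unitsField (toUField W) ⟨z, κ⟩) (fun κ z => X ⟨z, κ⟩) x = 0
  rw [divB_eq_zero_of_vanish (fun κ z => unitsField (toUField W) ⟨z, κ⟩) (fun κ z => X ⟨z, κ⟩) x h1 h2, smul_zero]

omit [Fact (0 < c₁)] in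
/-- ★ **THE SOURCE OF THE CUBE ROW LIVES ON THE BLOCKS NEAR THE CUBE**: with `R₀ = 3·L^s·L^{K−n}` (✓p757454's reach), `(toL2S)⁻¹(D*_W(toL2 X))` vanishes at every site whose coarse
block is farther than `3L^s + 4` from the block of `c` (§1 + the contraction B3 ✓`tdist_iterBlockOf_le`). [cite: Balaban1985BackgroundPropagators, (3.8) p.392; Balaban1985Averaging, (2) p.17] -/
theorem dstar_blockSupport (W : GaugeField (F.P K) 0 (Matrix.specialUnitaryGroup (Fin 2) ℂ)) (X : PBond (F.P K) 0 → Matrix (Fin 2) (Fin 2) ℂ)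
    (c : Site (F.P K) 0) (s : ℕ) (hX : ∀ b : PBond (F.P K) 0, X b ≠ 0 → Site.tdist c b.src ≤ 3 * (F.L ^ s * F.L ^ (K - n))) :
    ∀ x : Site (F.P K) 0, iterBlockOf (K - n) x ∉ (Finset.univ.filter fun z : Site (F.P K) (K - n) => Site.tdist z (iterBlockOf (K - n) c) ≤ 3 * F.L ^ s + 4) →
      (toL2S F K c₀).symm (DstarL2 F n K c₀ W (toL2 F K c₀ X)) x = 0 := by
  intro x hxS
  refine toL2S_symm_DstarL2_toL2_eq_zero_of_far F W X c hX x ?_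
  by_contra hle'
  have hle : Site.tdist c x ≤ 3 * (F.L ^ s * F.L ^ (K - n)) + 1 := not_lt.mp hle'
  apply hxS
  rw [Finset.mem_filter]
  refine ⟨Finset.mem_univ _, ?_⟩
  have hk : K - n ≤ (F.P K).m + (F.P K).K := by show K - n ≤ F.m + K; omega
  have hcon := tdist_iterBlockOf_le hk x c
  have hL1 : 1 ≤ F.L ^ (K - n) := Nat.one_le_pow _ _ F.hL.2.le
  have hPL : (F.P K).L = F.L := rfl
  have hd : (F.P K).d = 3 := rfl
  rw [hPL, hd] at hcon
  rw [B3Taylor310LocalRemainder.tdist_comm] at hle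
  have hdiv : Site.tdist x c / F.L ^ (K - n) ≤ 3 * F.L ^ s + 1 := by
    calc Site.tdist x c / F.L ^ (K - n) ≤ (3 * (F.L ^ s * F.L ^ (K - n)) + 1) / F.L ^ (K - n) := Nat.div_le_div_right hle
      _ = 1 / F.L ^ (K - n) + 3 * F.L ^ s := by rw [show 3 * (F.L ^ s * F.L ^ (K - n)) + 1 = 1 + (3 * F.L ^ s) * F.L ^ (K - n) by ring, Nat.add_mul_div_right _ _ (by omega)]
      _ ≤ 1 + 3 * F.L ^ s := by gcongr; exact Nat.div_le_self _ _
      _ = 3 * F.L ^ s + 1 := by ring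
  omega

/-! ## §2 The bridge: coarse-function rows ⟹ spike-sum rows -/

/-- ★ **px5 g11's COARSE-FUNCTION CURRENCY ⟹ THIS SEAT's SPIKE-SUM CURRENCY**: for ANY predicate `B` on the coarse `SiteL2K` and any block predicate `P`, if `B (ι d♭)` holds for every coarse
function `d♭` with `d♭ z ≠ 0 → P z`, then `B (Σ_y d_y • b_c y)` holds for every index vector `d` with `d_y ≠ 0 → P (σ y.1)` — the spike sum IS `ι` of the one-site function
`Σ_y d_y • δ_{σ y.1} ⊗ (√c₁)⁻¹E_{y.2}` (B2c ✓`spike_eq_lift`), supported on `σ` of `d`'s support. [cite: Balaban1985BackgroundPropagators, (3.16) p.393] -/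
theorem coarseRow_to_spikeRow
    (ι : (Site (F.P K) (K - n) → Matrix (Fin 2) (Fin 2) ℂ) →ₗ[ℂ] SiteL2K ℂ 3 (periodsT3 F n) c₁ W₂)
    (hι : ∀ c, ι c = toL2S F n c₁ (fun z => c (siteShift (sites_eq F n K h) z)))
    (B : SiteL2K ℂ 3 (periodsT3 F n) c₁ W₂ → Prop) (P : Site (F.P K) (K - n) → Prop)
    (hrow : ∀ db : Site (F.P K) (K - n) → Matrix (Fin 2) (Fin 2) ℂ, (∀ z, db z ≠ 0 → P z) → B (ι db))
    (d : Site (F.P n) 0 × (Fin 2 × Fin 2) → ℂ) (hd : ∀ y, d y ≠ 0 → P (siteShift (sites_eq F n K h) y.1)) :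
    B (∑ y, d y • (OrthonormalBasis.mk (orthonormal_spike F) (top_le_span_spike F) : OrthonormalBasis (Site (F.P n) 0 × (Fin 2 × Fin 2)) ℂ (SiteL2K ℂ 3 (periodsT3 F n) c₁ W₂)) y) := by
  set db : Site (F.P K) (K - n) → Matrix (Fin 2) (Fin 2) ℂ :=
    ∑ y, d y • (Pi.single (siteShift (sites_eq F n K h) y.1) ((((Real.sqrt c₁ : ℝ) : ℂ))⁻¹ • Matrix.single y.2.1 y.2.2 (1 : ℂ)) :
      Site (F.P K) (K - n) → Matrix (Fin 2) (Fin 2) ℂ) with hdb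
  have hsum : (∑ y, d y • (OrthonormalBasis.mk (orthonormal_spike F) (top_le_span_spike F) : OrthonormalBasis (Site (F.P n) 0 × (Fin 2 × Fin 2)) ℂ (SiteL2K ℂ 3 (periodsT3 F n) c₁ W₂)) y) = ι db := by
    rw [hdb, map_sum]
    refine Finset.sum_congr rfl fun y _ => ?_
    rw [map_smul, ← spike_eq_lift F h ι hι y]
  rw [hsum]
  refine hrow db fun z hz => ?_
  by_contra hPz
  apply hz
  rw [hdb, Finset.sum_apply]
  refine Finset.sum_eq_zero fun y _ => ?_
  rw [Pi.smul_apply]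
  by_cases hy : siteShift (sites_eq F n K h) y.1 = z
  · have hdy : d y = 0 := by
      by_contra hne
      exact hPz (hy ▸ hd y hne)
    rw [hdy, zero_smul]
  · have h0 : (Pi.single (siteShift (sites_eq F n K h) y.1) ((((Real.sqrt c₁ : ℝ) : ℂ))⁻¹ • Matrix.single y.2.1 y.2.2 (1 : ℂ)) :
        Site (F.P K) (K - n) → Matrix (Fin 2) (Fin 2) ℂ) z = 0 := Pi.single_eq_of_ne' hy _
    rw [h0, smul_zero]

/-! ## §3 px10 g11's `hloc` binder, letter for letter -/

include h in
/-- ★★★ **THE (L5″) ROW `hloc` OF ✓`Prop7LODAssemblyMember.curvedTarget_member`, PER CUBE** — from ✓p759359 `norm_inner_projR_sub_projR_le_of_opRow` at `U₀ := (axialT U₀ c)·U₀`, `V₀ := 1`,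
`u := (toL2S)⁻¹(D*(toL2 X̃))`, `S := S_c`, `N := N_c(r)`, for per-cube letter families `Qc Tc Gc` (any intertwiner ∕ adjoint ∕ massive inverse at the cube-gauged background — px10 picks the data of
record), the flat system `(Q1, T1, G1)` at `1`, background-free windows∕gap, and per cube the three px5-class rows `hop` (px5's coarse currency), `hRB1`, `hRB2` at `f_c`.  Conclusion = the
`hloc` binder VERBATIM with `δP` := ✓p759359's opRow constant. [cite: Balaban1985BackgroundPropagators, (3.20)–(3.26) pp.394–395, (3.49) p.399, (3.105)–(3.106) p.414] -/
theorem hloc_of_cube_rows (hnK : n < K) {ε₀ : ℝ} (hε₀ : 0 < ε₀) (hε7 : 10 ^ 7 * (F.L : ℝ) ^ 3 * ε₀ ≤ 1)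
    (U₀ : GaugeField (F.P K) 0 (Matrix.specialUnitaryGroup (Fin 2) ℂ)) (hreg : RegPr F n K ε₀ U₀)
    (ι : (Site (F.P K) (K - n) → Matrix (Fin 2) (Fin 2) ℂ) →ₗ[ℂ] SiteL2K ℂ 3 (periodsT3 F n) c₁ W₂)
    (hι : ∀ c, ι c = toL2S F n c₁ (fun z => c (siteShift (sites_eq F n K h) z)))
    {a : ℝ} (ha : 0 < a) (s : ℕ) (r : ℝ)
    -- per-cube letters at the cube-gauged background
    (Qc : Site (F.P K) 0 → (SiteL2K ℂ 3 (periodsT3 F K) c₀ W₂ →ₗ[ℂ] (Site (F.P K) (K - n) → Matrix (Fin 2) (Fin 2) ℂ)))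
    (hseqc : ∀ c : Site (F.P K) 0, (∀ lam : Site (F.P K) 0 → Matrix (Fin 2) (Fin 2) ℂ, ∃ ns : (j : ℕ) → Site (F.P K) j → Matrix (Fin 2) (Fin 2) ℂ, ns 0 = lam ∧
        (∀ (j : ℕ) (y : Site (F.P K) (j + 1)), ns (j + 1) y = ns j (emb y) - meanCLM (Idx (F.P K)) (Matrix (Fin 2) (Fin 2) ℂ) fun i : Idx (F.P K) =>
          ns j (emb y) - ((holT (emlIterU j (bgUnits F K (GaugeField.gaugeAct (axialT U₀ c) U₀))) (emb y) (stairWord i.2.1 (off i.1)) : (Matrix (Fin 2) (Fin 2) ℂ)ˣ) : Matrix (Fin 2) (Fin 2) ℂ) *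
            ns j (transl (emb y) (disp (stairWord i.2.1 (off i.1)))) * (((holT (emlIterU j (bgUnits F K (GaugeField.gaugeAct (axialT U₀ c) U₀))) (emb y) (stairWord i.2.1 (off i.1)))⁻¹ : (Matrix (Fin 2) (Fin 2) ℂ)ˣ) : Matrix (Fin 2) (Fin 2) ℂ)) ∧
        ns (K - n) = Qc c (toL2S F K c₀ lam)))
    (Tc : Site (F.P K) 0 → (SiteL2K ℂ 3 (periodsT3 F n) c₁ W₂ →ₗ[ℂ] SiteL2K ℂ 3 (periodsT3 F K) c₀ W₂))
    (hTc : ∀ (c : Site (F.P K) 0) (l : SiteL2K ℂ 3 (periodsT3 F K) c₀ W₂) (f : SiteL2K ℂ 3 (periodsT3 F n) c₁ W₂), ⟪ι (Qc c l), f⟫_ℂ = ⟪l, Tc c f⟫_ℂ)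
    (Gc : Site (F.P K) 0 → (SiteL2K ℂ 3 (periodsT3 F K) c₀ W₂ →ₗ[ℂ] SiteL2K ℂ 3 (periodsT3 F K) c₀ W₂))
    (hAGc : ∀ (c : Site (F.P K) 0) (f : SiteL2K ℂ 3 (periodsT3 F K) c₀ W₂), covLapSite F n K c₀ (GaugeField.gaugeAct (axialT U₀ c) U₀) (Gc c f) + (a : ℂ) • Tc c (ι (Qc c (Gc c f))) = f)
    (hGAc : ∀ (c : Site (F.P K) 0) (w : SiteL2K ℂ 3 (periodsT3 F K) c₀ W₂), Gc c (covLapSite F n K c₀ (GaugeField.gaugeAct (axialT U₀ c) U₀) w + (a : ℂ) • Tc c (ι (Qc c w))) = w)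
    -- the flat system at background `1`
    (Q1 : SiteL2K ℂ 3 (periodsT3 F K) c₀ W₂ →ₗ[ℂ] (Site (F.P K) (K - n) → Matrix (Fin 2) (Fin 2) ℂ))
    (hseq₁ : (∀ lam : Site (F.P K) 0 → Matrix (Fin 2) (Fin 2) ℂ, ∃ ns : (j : ℕ) → Site (F.P K) j → Matrix (Fin 2) (Fin 2) ℂ, ns 0 = lam ∧
      (∀ (j : ℕ) (y : Site (F.P K) (j + 1)), ns (j + 1) y = ns j (emb y) - meanCLM (Idx (F.P K)) (Matrix (Fin 2) (Fin 2) ℂ) fun i : Idx (F.P K) =>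
        ns j (emb y) - ((holT (emlIterU j (bgUnits F K (1 : GaugeField (F.P K) 0 (Matrix.specialUnitaryGroup (Fin 2) ℂ)))) (emb y) (stairWord i.2.1 (off i.1)) : (Matrix (Fin 2) (Fin 2) ℂ)ˣ) : Matrix (Fin 2) (Fin 2) ℂ) *
          ns j (transl (emb y) (disp (stairWord i.2.1 (off i.1)))) * (((holT (emlIterU j (bgUnits F K (1 : GaugeField (F.P K) 0 (Matrix.specialUnitaryGroup (Fin 2) ℂ)))) (emb y) (stairWord i.2.1 (off i.1)))⁻¹ : (Matrix (Fin 2) (Fin 2) ℂ)ˣ) : Matrix (Fin 2) (Fin 2) ℂ)) ∧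
      ns (K - n) = Q1 (toL2S F K c₀ lam)))
    (T1 : SiteL2K ℂ 3 (periodsT3 F n) c₁ W₂ →ₗ[ℂ] SiteL2K ℂ 3 (periodsT3 F K) c₀ W₂) (hT1 : ∀ (l : SiteL2K ℂ 3 (periodsT3 F K) c₀ W₂) (f : SiteL2K ℂ 3 (periodsT3 F n) c₁ W₂), ⟪ι (Q1 l), f⟫_ℂ = ⟪l, T1 f⟫_ℂ)
    (G1 : SiteL2K ℂ 3 (periodsT3 F K) c₀ W₂ →ₗ[ℂ] SiteL2K ℂ 3 (periodsT3 F K) c₀ W₂)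
    (hAG1 : ∀ f, covLapSite F n K c₀ (1 : GaugeField (F.P K) 0 (Matrix.specialUnitaryGroup (Fin 2) ℂ)) (G1 f) + (a : ℂ) • T1 (ι (Q1 (G1 f))) = f)
    (hGA1 : ∀ w, G1 (covLapSite F n K c₀ (1 : GaugeField (F.P K) 0 (Matrix.specialUnitaryGroup (Fin 2) ℂ)) w + (a : ℂ) • T1 (ι (Q1 w))) = w)
    -- windows (slope μ), window + gap (slope μ′) — background-free
    {μ μ' : ℝ} (hμ' : 0 < μ') (hμμ' : μ' < μ)
    {δ₁ : ℝ} (hδ₁ : 0 ≤ δ₁) (hδ : 3 * ((eta F n K)⁻¹) ^ 2 * (Real.exp (μ * eta F n K) - 1) ^ 2 + a * ((25 / 8) * (c₁ * ((((F.P K).L : ℝ) ^ (F.P K).d) ^ (K - n))⁻¹ / c₀)) * (Real.exp (3 * μ) - 1) ^ 2 ≤ δ₁ ^ 2) (hwin : Real.sqrt (max 2 (16 * c₀ * ((F.L : ℝ) ^ (K - n)) ^ 3 / (a * c₁))) * δ₁ ≤ 1 / 10)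
    {δ₁' : ℝ} (hδ₁' : 0 ≤ δ₁') (hδV : 3 * ((eta F n K)⁻¹) ^ 2 * (Real.exp (μ' * eta F n K) - 1) ^ 2 + a * ((25 / 8) * (c₁ * ((((F.P K).L : ℝ) ^ (F.P K).d) ^ (K - n))⁻¹ / c₀)) * (Real.exp (3 * μ') - 1) ^ 2 ≤ δ₁' ^ 2) (hwinV : Real.sqrt (max 2 (16 * c₀ * ((F.L : ℝ) ^ (K - n)) ^ 3 / (a * c₁))) * δ₁' ≤ 1 / 10)
    (hgapV : 3 * ((Real.sqrt (max 2 (16 * c₀ * ((F.L : ℝ) ^ (K - n)) ^ 3 / (a * c₁))) * (2 + Real.sqrt (max 2 (16 * c₀ * ((F.L : ℝ) ^ (K - n)) ^ 3 / (a * c₁))))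
          * (Real.sqrt 3 * (eta F n K)⁻¹ * (Real.exp (μ' * eta F n K) - 1) + (Real.sqrt 3 * (eta F n K)⁻¹ * (Real.exp (μ' * eta F n K) - 1)) ^ 2 + Real.sqrt a * (Real.sqrt ((25 / 8) * (c₁ * ((((F.P K).L : ℝ) ^ (F.P K).d) ^ (K - n))⁻¹ / c₀))) * (Real.exp (3 * μ') - 1) + a * (Real.sqrt ((25 / 8) * (c₁ * ((((F.P K).L : ℝ) ^ (F.P K).d) ^ (K - n))⁻¹ / c₀))) ^ 2 * (Real.exp (3 * μ') - 1) ^ 2)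
          * (8 * Real.sqrt (max 2 (16 * c₀ * ((F.L : ℝ) ^ (K - n)) ^ 3 / (a * c₁))) + 8 * Real.sqrt (max 2 (16 * c₀ * ((F.L : ℝ) ^ (K - n)) ^ 3 / (a * c₁))) ^ 2)
          * ((Real.sqrt ((25 / 8) * (c₁ * ((((F.P K).L : ℝ) ^ (F.P K).d) ^ (K - n))⁻¹ / c₀))) * (1 + (Real.exp (3 * μ') - 1))) + (max 2 (16 * c₀ * ((F.L : ℝ) ^ (K - n)) ^ 3 / (a * c₁))) * ((Real.sqrt ((25 / 8) * (c₁ * ((((F.P K).L : ℝ) ^ (F.P K).d) ^ (K - n))⁻¹ / c₀))) * (Real.exp (3 * μ') - 1)))) ^ 2 < (2 / ((1 + (25 / 8) * (c₁ * ((((F.P K).L : ℝ) ^ (F.P K).d) ^ (K - n))⁻¹ / c₀)) * (600 * (27 / 4 : ℝ) ^ 6 * (c₀ * ((F.L : ℝ) ^ 3) ^ (K - n) / c₁) + a))) ^ 2 / 2)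
    -- the three px5-class rows per cube
    {cG cQ εN : ℝ} (hcG : 0 ≤ cG) (hcQ : 0 ≤ cQ) (hεN : 0 ≤ εN)
    (hop : ∀ (c : Site (F.P K) 0) (db : Site (F.P K) (K - n) → Matrix (Fin 2) (Fin 2) ℂ),
      (∀ z, db z ≠ 0 → ∃ z' ∈ (Finset.univ.filter fun z : Site (F.P K) (K - n) => Site.tdist z (iterBlockOf (K - n) c) ≤ 3 * F.L ^ s + 4), (Site.tdist (P := F.P K) z' z : ℝ) < r) →
        ‖ι (Q1 (G1 (G1 (T1 (ι db))))) - ι (Qc c (Gc c (Gc c (Tc c (ι db)))))‖ ≤ εN * ‖ι db‖)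
    (hRB1 : ∀ (c : Site (F.P K) 0) (X : PBond (F.P K) 0 → Matrix (Fin 2) (Fin 2) ℂ),
      (∀ b : PBond (F.P K) 0, X b ≠ 0 → Site.tdist c b.src ≤ (3 * (F.L ^ s * F.L ^ (K - n)))) →
        ‖Gc c (DstarL2 F n K c₀ (GaugeField.gaugeAct (axialT U₀ c) U₀) (toL2 F K c₀ (fun b => ((axialT U₀ c b.src : Matrix.specialUnitaryGroup (Fin 2) ℂ) : Matrix (Fin 2) (Fin 2) ℂ) * X b * star ((axialT U₀ c b.src : Matrix.specialUnitaryGroup (Fin 2) ℂ) : Matrix (Fin 2) (Fin 2) ℂ)))) - G1 (DstarL2 F n K c₀ (GaugeField.gaugeAct (axialT U₀ c) U₀) (toL2 F K c₀ (fun b => ((axialT U₀ c b.src : Matrix.specialUnitaryGroup (Fin 2) ℂ) : Matrix (Fin 2) (Fin 2) ℂ) * X b * star ((axialT U₀ c b.src : Matrix.specialUnitaryGroup (Fin 2) ℂ) : Matrix (Fin 2) (Fin 2) ℂ))))‖ ≤ cG * ‖DstarL2 F n K c₀ (GaugeField.gaugeAct (axialT U₀ c) U₀) (toL2 F K c₀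 (fun b => ((axialT U₀ c b.src : Matrix.specialUnitaryGroup (Fin 2) ℂ) : Matrix (Fin 2) (Fin 2) ℂ) * X b * star ((axialT U₀ c b.src : Matrix.specialUnitaryGroup (Fin 2) ℂ) : Matrix (Fin 2) (Fin 2) ℂ)))‖)
    (hRB2 : ∀ (c : Site (F.P K) 0) (X : PBond (F.P K) 0 → Matrix (Fin 2) (Fin 2) ℂ),
      (∀ b : PBond (F.P K) 0, X b ≠ 0 → Site.tdist c b.src ≤ (3 * (F.L ^ s * F.L ^ (K - n)))) →
        ‖ι (Qc c (G1 (DstarL2 F n K c₀ (GaugeField.gaugeAct (axialT U₀ c) U₀) (toL2 F K c₀ (fun b => ((axialT U₀ c b.src : Matrix.specialUnitaryGroup (Fin 2) ℂ) : Matrix (Fin 2) (Fin 2) ℂ) * X b * star ((axialT U₀ c b.src : Matrix.specialUnitaryGroup (Fin 2) ℂ) : Matrix (Fin 2) (Fin 2) ℂ)))))) - ι (Q1 (G1 (DstarL2 F n K c₀ (GaugeField.gaugeAct (axialT U₀ c) U₀) (toL2 F K c₀ (fun b => ((axialT U₀ c b.src : Matrix.specialUnitaryGroup (Fin 2) ℂ)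 : Matrix (Fin 2) (Fin 2) ℂ) * X b * star ((axialT U₀ c b.src : Matrix.specialUnitaryGroup (Fin 2) ℂ) : Matrix (Fin 2) (Fin 2) ℂ))))))‖ ≤ cQ * ‖DstarL2 F n K c₀ (GaugeField.gaugeAct (axialT U₀ c) U₀) (toL2 F K c₀ (fun b => ((axialT U₀ c b.src : Matrix.specialUnitaryGroup (Fin 2) ℂ) : Matrix (Fin 2) (Fin 2) ℂ) * X b * star ((axialT U₀ c b.src : Matrix.specialUnitaryGroup (Fin 2) ℂ) : Matrix (Fin 2) (Fin 2) ℂ)))‖) :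
    ∀ c : Site (F.P K) 0, ∃ Qc : SiteL2K ℂ 3 (periodsT3 F K) c₀ W₂ →ₗ[ℂ] (Site (F.P K) (K - n) → Matrix (Fin 2) (Fin 2) ℂ),
      (∀ lam : Site (F.P K) 0 → Matrix (Fin 2) (Fin 2) ℂ, ∃ ns : (j : ℕ) → Site (F.P K) j → Matrix (Fin 2) (Fin 2) ℂ, ns 0 = lam ∧
        (∀ (j : ℕ) (y : Site (F.P K) (j + 1)), ns (j + 1) y = ns j (emb y) - meanCLM (Idx (F.P K)) (Matrix (Fin 2) (Fin 2) ℂ) fun i : Idx (F.P K) =>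
          ns j (emb y) - ((holT (emlIterU j (bgUnits F K (GaugeField.gaugeAct (axialT U₀ c) U₀))) (emb y) (stairWord i.2.1 (off i.1)) : (Matrix (Fin 2) (Fin 2) ℂ)ˣ) : Matrix (Fin 2) (Fin 2) ℂ) *
            ns j (transl (emb y) (disp (stairWord i.2.1 (off i.1)))) * (((holT (emlIterU j (bgUnits F K (GaugeField.gaugeAct (axialT U₀ c) U₀))) (emb y) (stairWord i.2.1 (off i.1)))⁻¹ : (Matrix (Fin 2) (Fin 2) ℂ)ˣ) : Matrix (Fin 2) (Fin 2) ℂ)) ∧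
        ns (K - n) = Qc (toL2S F K c₀ lam)) ∧
      ∀ X : PBond (F.P K) 0 → Matrix (Fin 2) (Fin 2) ℂ, (∀ b : PBond (F.P K) 0, X b ≠ 0 → Site.tdist c b.src ≤ (3 * (F.L ^ s * F.L ^ (K - n)))) →
        ‖⟪DstarL2 F n K c₀ (GaugeField.gaugeAct (axialT U₀ c) U₀) (toL2 F K c₀ (fun b => ((axialT U₀ c b.src : Matrix.specialUnitaryGroup (Fin 2) ℂ) : Matrix (Fin 2) (Fin 2) ℂ) * X b * star ((axialT U₀ c b.src : Matrix.specialUnitaryGroup (Fin 2) ℂ) : Matrix (Fin 2) (Fin 2) ℂ))),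
            (DstarL2 F n K c₀ (GaugeField.gaugeAct (axialT U₀ c) U₀) (toL2 F K c₀ (fun b => ((axialT U₀ c b.src : Matrix.specialUnitaryGroup (Fin 2) ℂ) : Matrix (Fin 2) (Fin 2) ℂ) * X b * star ((axialT U₀ c b.src : Matrix.specialUnitaryGroup (Fin 2) ℂ) : Matrix (Fin 2) (Fin 2) ℂ))) - projR (covLapSite F n K c₀ (GaugeField.gaugeAct (axialT U₀ c) U₀)) Qc (DstarL2 F n K c₀ (GaugeField.gaugeAct (axialT U₀ c) U₀) (toL2 F K c₀ (fun b => ((axialT U₀ c b.src : Matrix.specialUnitaryGroup (Fin 2) ℂ) : Matrix (Fin 2) (Fin 2) ℂ) * X b * star ((axialT U₀ c b.src : Matrix.specialUnitaryGroup (Fin 2) ℂ) : Matrix (Fin 2) (Fin 2) ℂ)))))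
            - (DstarL2 F n K c₀ (GaugeField.gaugeAct (axialT U₀ c) U₀) (toL2 F K c₀ (fun b => ((axialT U₀ c b.src : Matrix.specialUnitaryGroup (Fin 2) ℂ) : Matrix (Fin 2) (Fin 2) ℂ) * X b * star ((axialT U₀ c b.src : Matrix.specialUnitaryGroup (Fin 2) ℂ) : Matrix (Fin 2) (Fin 2) ℂ))) - projR (covLapSite F n K c₀ 1) Q1 (DstarL2 F n K c₀ (GaugeField.gaugeAct (axialT U₀ c) U₀) (toL2 F K c₀ (fun b => ((axialT U₀ c b.src : Matrix.specialUnitaryGroup (Fin 2) ℂ) : Matrix (Fin 2) (Fin 2) ℂ) * X b * star ((axialT U₀ c b.src : Matrix.specialUnitaryGroup (Fin 2) ℂ) : Matrix (Fin 2) (Fin 2) ℂ)))))⟫_ℂ‖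
          ≤ ((Real.sqrt ((25 / 8) * (c₁ * ((((F.P K).L : ℝ) ^ (F.P K).d) ^ (K - n))⁻¹ / c₀)) * cG + cQ) * ((2 / ((1 + (25 / 8) * (c₁ * ((((F.P K).L : ℝ) ^ (F.P K).d) ^ (K - n))⁻¹ / c₀)) * (600 * (27 / 4 : ℝ) ^ 6 * (c₀ * ((F.L : ℝ) ^ 3) ^ (K - n) / c₁) + a))) ^ 2)⁻¹ * (Real.sqrt ((25 / 8) * (c₁ * ((((F.P K).L : ℝ) ^ (F.P K).d) ^ (K - n))⁻¹ / c₀)) * (max 2 (16 * c₀ * ((F.L : ℝ) ^ (K - n)) ^ 3 / (a * c₁)))) + (Real.sqrt ((25 / 8) * (c₁ * ((((F.P K).L : ℝ) ^ (F.P K).d) ^ (K - n))⁻¹ / c₀)) * (max 2 (16 * c₀ * ((F.L : ℝ) ^ (K - n)) ^ 3 / (a * c₁)))) * (((2 / ((1 + (25 / 8) * (c₁ * ((((F.P K).L : ℝ) ^ (F.P K).d) ^ (K - n))⁻¹ / c₀)) * (600 * (27 / 4 : ℝ) ^ 6 * (c₀ * ((F.L : ℝ) ^ 3) ^ (K - n)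 / c₁) + a))) ^ 2)⁻¹ * (εN * (((2 / ((1 + (25 / 8) * (c₁ * ((((F.P K).L : ℝ) ^ (F.P K).d) ^ (K - n))⁻¹ / c₀)) * (600 * (27 / 4 : ℝ) ^ 6 * (c₀ * ((F.L : ℝ) ^ 3) ^ (K - n) / c₁) + a))) ^ 2)⁻¹ * (Real.sqrt ((25 / 8) * (c₁ * ((((F.P K).L : ℝ) ^ (F.P K).d) ^ (K - n))⁻¹ / c₀)) * (max 2 (16 * c₀ * ((F.L : ℝ) ^ (K - n)) ^ 3 / (a * c₁))))) + (Real.sqrt ((25 / 8) * (c₁ * ((((F.P K).L : ℝ) ^ (F.P K).d) ^ (K - n))⁻¹ / c₀)) * (max 2 (16 * c₀ * ((F.L : ℝ) ^ (K - n)) ^ 3 / (a * c₁))) ^ 2 * Real.sqrt ((25 / 8) * (c₁ * ((((F.P K).L : ℝ) ^ (F.P K).d) ^ (K - n))⁻¹ / c₀)) + Real.sqrt ((25 / 8) * (c₁ * ((((F.P K).L : ℝ) ^ (F.P K).d) ^ (K - n))⁻¹ / c₀)) * (max 2 (16 * c₀ * ((F.L : ℝ) ^ (K - n)) ^ 3 /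 (a * c₁))) ^ 2 * Real.sqrt ((25 / 8) * (c₁ * ((((F.P K).L : ℝ) ^ (F.P K).d) ^ (K - n))⁻¹ / c₀))) * ((((2 / ((1 + (25 / 8) * (c₁ * ((((F.P K).L : ℝ) ^ (F.P K).d) ^ (K - n))⁻¹ / c₀)) * (600 * (27 / 4 : ℝ) ^ 6 * (c₀ * ((F.L : ℝ) ^ 3) ^ (K - n) / c₁) + a))) ^ 2 / 2 - 3 * ((Real.sqrt (max 2 (16 * c₀ * ((F.L : ℝ) ^ (K - n)) ^ 3 / (a * c₁))) * (2 + Real.sqrt (max 2 (16 * c₀ * ((F.L : ℝ) ^ (K - n)) ^ 3 / (a * c₁))))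
          * (Real.sqrt 3 * (eta F n K)⁻¹ * (Real.exp (μ' * eta F n K) - 1) + (Real.sqrt 3 * (eta F n K)⁻¹ * (Real.exp (μ' * eta F n K) - 1)) ^ 2 + Real.sqrt a * (Real.sqrt ((25 / 8) * (c₁ * ((((F.P K).L : ℝ) ^ (F.P K).d) ^ (K - n))⁻¹ / c₀))) * (Real.exp (3 * μ') - 1) + a * (Real.sqrt ((25 / 8) * (c₁ * ((((F.P K).L : ℝ) ^ (F.P K).d) ^ (K - n))⁻¹ / c₀))) ^ 2 * (Real.exp (3 * μ') - 1) ^ 2)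
          * (8 * Real.sqrt (max 2 (16 * c₀ * ((F.L : ℝ) ^ (K - n)) ^ 3 / (a * c₁))) + 8 * Real.sqrt (max 2 (16 * c₀ * ((F.L : ℝ) ^ (K - n)) ^ 3 / (a * c₁))) ^ 2)
          * ((Real.sqrt ((25 / 8) * (c₁ * ((((F.P K).L : ℝ) ^ (F.P K).d) ^ (K - n))⁻¹ / c₀))) * (1 + (Real.exp (3 * μ') - 1))) + (max 2 (16 * c₀ * ((F.L : ℝ) ^ (K - n)) ^ 3 / (a * c₁))) * ((Real.sqrt ((25 / 8) * (c₁ * ((((F.P K).L : ℝ) ^ (F.P K).d) ^ (K - n))⁻¹ / c₀))) * (Real.exp (3 * μ') - 1)))) ^ 2)⁻¹ * Real.exp (9 * μ')) * (8 * (max 2 (16 * c₀ * ((F.L : ℝ) ^ (K - n)) ^ 3 / (a * c₁))) * Real.sqrt ((25 / 8) * (c₁ * ((((F.P K).L : ℝ) ^ (F.P K).d) ^ (K - n))⁻¹ / c₀)) * Real.exp (3 * μ)) * (4 * (2 * (1 + 1 / (μ - μ'))) ^ 3) * Real.sqrt ((2 * (1 + 1 / (μ' / 2))) ^ 3 * (4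 * (2 * (1 + 1 / (μ' / 2))) ^ 3)) * Real.exp (-(μ' * r / 2))))) + (Real.sqrt ((25 / 8) * (c₁ * ((((F.P K).L : ℝ) ^ (F.P K).d) ^ (K - n))⁻¹ / c₀)) * (max 2 (16 * c₀ * ((F.L : ℝ) ^ (K - n)) ^ 3 / (a * c₁)))) * ((2 / ((1 + (25 / 8) * (c₁ * ((((F.P K).L : ℝ) ^ (F.P K).d) ^ (K - n))⁻¹ / c₀)) * (600 * (27 / 4 : ℝ) ^ 6 * (c₀ * ((F.L : ℝ) ^ 3) ^ (K - n) / c₁) + a))) ^ 2)⁻¹ * (Real.sqrt ((25 / 8) * (c₁ * ((((F.P K).L : ℝ) ^ (F.P K).d) ^ (K - n))⁻¹ / c₀)) * cG + cQ))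
          * ‖DstarL2 F n K c₀ (GaugeField.gaugeAct (axialT U₀ c) U₀) (toL2 F K c₀ (fun b => ((axialT U₀ c b.src : Matrix.specialUnitaryGroup (Fin 2) ℂ) : Matrix (Fin 2) (Fin 2) ℂ) * X b * star ((axialT U₀ c b.src : Matrix.specialUnitaryGroup (Fin 2) ℂ) : Matrix (Fin 2) (Fin 2) ℂ)))‖ ^ 2 := by
  intro c
  refine ⟨Qc c, hseqc c, fun X hX => ?_⟩
  have hregW : RegPr F n K ε₀ (GaugeField.gaugeAct (axialT U₀ c) U₀) := (regPr_gaugeAct_iff F hε₀.le (axialT U₀ c) U₀).mpr hreg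
  have hreg1 : RegPr F n K ε₀ (1 : GaugeField (F.P K) 0 (Matrix.specialUnitaryGroup (Fin 2) ℂ)) := regPr_one (F := F) (n := n) (K := K) hε₀
  set f : SiteL2K ℂ 3 (periodsT3 F K) c₀ W₂ := DstarL2 F n K c₀ (GaugeField.gaugeAct (axialT U₀ c) U₀) (toL2 F K c₀ (fun b => ((axialT U₀ c b.src : Matrix.specialUnitaryGroup (Fin 2) ℂ) : Matrix (Fin 2) (Fin 2) ℂ) * X b * star ((axialT U₀ c b.src : Matrix.specialUnitaryGroup (Fin 2) ℂ) : Matrix (Fin 2) (Fin 2) ℂ))) with hf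
  have hfu : toL2S F K c₀ ((toL2S F K c₀).symm f) = f := (toL2S F K c₀).apply_symm_apply f
  have hu := dstar_blockSupport F (n := n) (c₀ := c₀) (GaugeField.gaugeAct (axialT U₀ c) U₀) (fun b => ((axialT U₀ c b.src : Matrix.specialUnitaryGroup (Fin 2) ℂ) : Matrix (Fin 2) (Fin 2) ℂ) * X b * star ((axialT U₀ c b.src : Matrix.specialUnitaryGroup (Fin 2) ℂ) : Matrix (Fin 2) (Fin 2) ℂ)) c s ?_
  swap
  · intro b hb
    refine hX b ?_
    intro hXb
    exact hb (by rw [hXb, mul_zero, zero_mul])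
  have hfar : ∀ i : Site (F.P n) 0 × (Fin 2 × Fin 2), i ∉ ((Finset.univ.filter fun z : Site (F.P K) (K - n) => Site.tdist z (iterBlockOf (K - n) c) ≤ 3 * F.L ^ s + 4).biUnion fun z => Finset.univ.filter fun i : Site (F.P n) 0 × (Fin 2 × Fin 2) => (Site.tdist (P := F.P K) z (siteShift (sites_eq F n K h) i.1) : ℝ) < r) →
      ∀ z ∈ (Finset.univ.filter fun z : Site (F.P K) (K - n) => Site.tdist z (iterBlockOf (K - n) c) ≤ 3 * F.L ^ s + 4), r ≤ (Site.tdist (P := F.P K) z (siteShift (sites_eq F n K h) i.1) : ℝ) := by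
    intro i hi z hz
    by_contra hlt
    exact hi (Finset.mem_biUnion.mpr ⟨z, hz, Finset.mem_filter.mpr ⟨Finset.mem_univ _, not_le.mp hlt⟩⟩)
  have hop' : ∀ d : Site (F.P n) 0 × (Fin 2 × Fin 2) → ℂ, (∀ y, y ∉ ((Finset.univ.filter fun z : Site (F.P K) (K - n) => Site.tdist z (iterBlockOf (K - n) c) ≤ 3 * F.L ^ s + 4).biUnion fun z => Finset.univ.filter fun i : Site (F.P n) 0 × (Fin 2 × Fin 2) => (Site.tdist (P := F.P K) z (siteShift (sites_eq F n K h) i.1) : ℝ) < r) → d y = 0) →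
      ‖ι (Q1 (G1 (G1 (T1 (∑ y', d y' • (OrthonormalBasis.mk (orthonormal_spike F) (top_le_span_spike F) : OrthonormalBasis (Site (F.P n) 0 × (Fin 2 × Fin 2)) ℂ (SiteL2K ℂ 3 (periodsT3 F n) c₁ W₂)) y')))))
        - ι (Qc c (Gc c (Gc c (Tc c (∑ y', d y' • (OrthonormalBasis.mk (orthonormal_spike F) (top_le_span_spike F) : OrthonormalBasis (Site (F.P n) 0 × (Fin 2 × Fin 2)) ℂ (SiteL2K ℂ 3 (periodsT3 F n) c₁ W₂)) y')))))‖
        ≤ εN * ‖∑ y', d y' • (OrthonormalBasis.mk (orthonormal_spike F) (top_le_span_spike F) : OrthonormalBasis (Site (F.P n) 0 × (Fin 2 × Fin 2)) ℂ (SiteL2K ℂ 3 (periodsT3 F n) c₁ W₂)) y'‖ := by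
    intro d hd
    refine coarseRow_to_spikeRow F h ι hι
      (fun v => ‖ι (Q1 (G1 (G1 (T1 v)))) - ι (Qc c (Gc c (Gc c (Tc c v))))‖ ≤ εN * ‖v‖)
      (fun z => ∃ z' ∈ (Finset.univ.filter fun z : Site (F.P K) (K - n) => Site.tdist z (iterBlockOf (K - n) c) ≤ 3 * F.L ^ s + 4), (Site.tdist (P := F.P K) z' z : ℝ) < r) (hop c) d fun y hy => ?_
    by_contra hno
    refine hy (hd y fun hmem => hno ?_)
    obtain ⟨z, hz, hm⟩ := Finset.mem_biUnion.mp hmem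
    exact ⟨z, hz, (Finset.mem_filter.mp hm).2⟩
  have key := norm_inner_projR_sub_projR_le_of_opRow F h hε₀ hε7 (GaugeField.gaugeAct (axialT U₀ c) U₀) hregW (Qc c) (hseqc c) ι hι (Tc c) (hTc c) ha (Gc c) (hAGc c) (hGAc c)
    (1 : GaugeField (F.P K) 0 (Matrix.specialUnitaryGroup (Fin 2) ℂ)) hreg1 Q1 hseq₁ T1 hT1 G1 hAG1 hGA1 hnK hμ' hμμ' hδ₁ hδ hwin hδ₁' hδV hwinV hgapV
    hcG hcQ hεN ((Finset.univ.filter fun z : Site (F.P K) (K - n) => Site.tdist z (iterBlockOf (K - n) c) ≤ 3 * F.L ^ s + 4).biUnion fun z => Finset.univ.filter fun i : Site (F.P n) 0 × (Fin 2 × Fin 2) => (Site.tdist (P := F.P K) z (siteShift (sites_eq F n K h) i.1) : ℝ) < r) hop' (Finset.univ.filter fun z : Site (F.P K) (K - n) => Site.tdist z (iterBlockOf (K - n) c) ≤ 3 * F.L ^ s + 4) ((toL2S F K c₀).symm f) hu hfar ?_ ?_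
  · rw [hfu] at key
    exact key
  · rw [hfu]; exact hRB1 c X hX
  · rw [hfu]; exact hRB2 c X hX

end Summit.QuantumFields.YangMills.Theorems.Prop7LocalProjectorRowCube

end
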